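import Summits.ResolutionOfSingularities.ResolutionOfSingularities.Theorems.EquisingularLiftEquisingularLiftNatClusterLiftStrictTransformCharts
import Summits.ResolutionOfSingularities.ResolutionOfSingularities.Theorems.EquisingularLiftEquisingularLiftNatBlowupSubstSquarefree
import Mathlib
import HarnessLib

/-!
# [OURS · L1 W4.5(b)] T-CLUSTER-LIFT part 10 — the strict transform of a REDUCED plane trace at a point of EXACT multiplicity `m` in
# GENERAL position is square-free, hence Δ4-finite: the hypothesis `hfinst` of part 9 discharged from downstairs data
# (crux `EquisingularLiftNat` = stmt-ResolutionOfSingularities-20038 / child stmt-…-20148; rung v7′ TC⁺⁺, supplier brick (β))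

NOT a statement of any manuscript. Helper file of the chain res-L1-w45b (cell `res-hironaka`, LADDER-RESOLUTION rung L, slot
W4.5(b)); OURS; AI-written, weaker than expert review; `--supports stmt-ResolutionOfSingularities-20038 --as helper` by
res-L1-w45b-stub-3 (T-CLUSTER-LIFT part 10 = brick (β) of `L/res-L1-w45b-stub-3/TCPP-SUPPLIER-MAP.md`). No `sorry`; standard axioms.

WHAT. res-L1-w45b-stub-4's T-ΔLIFT-CENTRED-SQF (…NatBlowupSubstSquarefree p525038 / …NatStrictTransformSquarefree p525610) proves, AT THE
VERTEX `[1:0:0]`, that the strict transforms `gu, gv` of a reduced trace with exact multiplicity are square-free, hence have finite bad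
sets. Part 9's cone theorem `exists_isHomogeneous_clusterLift_deltaRegular_stCharts` needs the same at a point `a` in GENERAL position
for the chart map `st_{a,p,m}(f) = (β_p (f(X + a))) /ᵐᵒⁿ X_p^m` (translation, then stub-4's substitution `β_p : X_p ↦ X_p, X_l ↦ X_p X_l`,
then division by `X_p^m`). This file:

* `aeval_blowupSubst_monomial` — `β_p (X^γ) = X_p^{|γ|} · X^{γ∖p}` (exponent `single p |γ| + γ.erase p`), and `blowupExponent_injective`;
* `coeff_erase_divMonomial_blowupSubst` — for `F ∈ (X)^m` and `|α| = m`: the coefficient of `X^{α∖p}` in `st = (β_p F) /ᵐᵒⁿ X_p^m` is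
  `coeff_α F` (the degree-`m` part of `F` survives, dehomogenised at `p`); hence `not_X_dvd_divMonomial_blowupSubst` (EXACT order `m`,
  i.e. some `coeff_α F ≠ 0` with `|α| = m`, ⇒ `X_p ∤ st`) and `divMonomial_blowupSubst_ne_zero`;
* `squarefree_aeval_X_add_C` — translation preserves square-freeness (it is a ring automorphism; res-type-032's `squarefree_map_of_mulEquiv`);
  `aeval_X_add_C_mem_pow_idealOfVars` / `exists_coeff_ne_zero_of_not_mem_pow` — `f ∈ 𝔪_a^m ∖ 𝔪_a^{m+1}` read on `f(X + a)`;
* **`squarefree_stChart`** — `f` square-free with `f ∈ 𝔪_a^m ∖ 𝔪_a^{m+1}` ⇒ `st_{a,p,m}(f)` is non-zero, not divisible by `X_p`, and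
  SQUARE-FREE (stub-4's `squarefree_of_aeval_blowupSubst_eq`);
* **`finite_setOf_mem_sq_stChart`** — on a chart `i : Fin 3` of `ℙ²`: the bad set `{𝔮 | st ∈ 𝔮, st ∈ 𝔪_𝔮²}` of `st_{a,p,m}(f)` is FINITE
  (res-type-032's `finite_setOf_mem_sq_chart`, p516860) = part 9's `hfinst t p` for `f := g(T_{i t} := 1)`, `a := ā_t`, `m := m t`, from
  the `FatCluster` clauses (EXACT ORDER) and the reducedness of the trace on the chart (`ReducedConeForm` (R2) ⇒ square-free, tree
  `squarefree_dehomogenize_of_isHomogeneous` / stub-4's `…_of_squarefree`).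

References: parts 1, 9; res-L1-w45b-stub-4 p525038 / p525610 (vertex case, `squarefree_of_aeval_blowupSubst_eq`); res-type-032 …NatDeltaConeLiftPlane
p516860 (`finite_setOf_mem_sq_chart`, `squarefree_map_of_mulEquiv`). res-L1-w45b-lead-2 / -stub-1 (OURS planning texts, index only).
-/

set_option linter.dupNamespace false -- mandated namespace `Summit.<Summit>.<Problem>` of this single-conjunct summit

noncomputable section

open MvPolynomial IsLocalRing Literature.AlgebraicGeometry.Resolution
open Summit.ResolutionOfSingularities.ResolutionOfSingularities.Theorems
open Summit.ResolutionOfSingularities.ResolutionOfSingularities.Theorems.EquisingularLiftNat.ClusterLift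

namespace Summit.ResolutionOfSingularities.ResolutionOfSingularities.Cruxes.EquisingularLiftNat.Sections

universe u

/-! ## The blow-up substitution on monomials -/

section Monomial

variable {R : Type*} [CommRing R] {τ : Type*} [Fintype τ] [DecidableEq τ] (p : τ)

/-- **`β_p` on monomials**: `β_p (c X^γ) = c · X_p^{|γ|} · ∏_{l ≠ p} X_l^{γ_l}`, i.e. the monomial with exponent
`single p |γ| + γ.erase p`. [folklore] -/
theorem aeval_blowupSubst_monomial (γ : τ →₀ ℕ) (c : R) :
    aeval (fun j => if j = p then (X p : MvPolynomial τ R) else X p * X j) (monomial γ c) =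
      monomial (Finsupp.single p γ.degree + γ.erase p) c := by
  rw [aeval_monomial, algebraMap_eq, Finsupp.prod_fintype _ _ (fun _ => pow_zero _), monomial_eq,
    Finsupp.prod_fintype _ _ (fun _ => pow_zero _)]
  congr 1
  rw [← Finset.mul_prod_erase _ _ (Finset.mem_univ p), ← Finset.mul_prod_erase Finset.univ _ (Finset.mem_univ p),
    if_pos rfl, Finsupp.add_apply, Finsupp.single_eq_same, Finsupp.erase_same, add_zero]
  have h1 : ∏ j ∈ Finset.univ.erase p, (if j = p then (X p : MvPolynomial τ R) else X p * X j) ^ γ j =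
      X p ^ (∑ j ∈ Finset.univ.erase p, γ j) * ∏ j ∈ Finset.univ.erase p, (X j : MvPolynomial τ R) ^ γ j := by
    rw [← Finset.prod_pow_eq_pow_sum, ← Finset.prod_mul_distrib]
    refine Finset.prod_congr rfl fun j hj => ?_
    rw [if_neg (Finset.ne_of_mem_erase hj), mul_pow]
  have h2 : ∏ j ∈ Finset.univ.erase p, (X j : MvPolynomial τ R) ^ (Finsupp.single p γ.degree + γ.erase p) j =
      ∏ j ∈ Finset.univ.erase p, (X j : MvPolynomial τ R) ^ γ j := by
    refine Finset.prod_congr rfl fun j hj => ?_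
    rw [Finsupp.add_apply, Finsupp.single_apply, if_neg (Finset.ne_of_mem_erase hj).symm, zero_add,
      Finsupp.erase_ne (Finset.ne_of_mem_erase hj)]
  rw [h1, h2, ← mul_assoc, ← pow_add]
  congr 2
  rw [Finsupp.degree_eq_sum, ← Finset.add_sum_erase _ _ (Finset.mem_univ p)]

omit [Fintype τ] in
/-- The exponent map `γ ↦ single p |γ| + γ.erase p` of `β_p` is injective. [folklore] -/
theorem blowupExponent_injective :
    Function.Injective fun γ : τ →₀ ℕ => Finsupp.single p γ.degree + γ.erase p := by
  intro γ γ' h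
  have he : γ.erase p = γ'.erase p := by
    have := congrArg (Finsupp.erase p) h
    simpa [Finsupp.erase_add, Finsupp.erase_single] using this
  have hd : γ.degree = γ'.degree := by
    have := congrArg (fun e : τ →₀ ℕ => e p) h
    simpa [Finsupp.add_apply, Finsupp.single_eq_same, Finsupp.erase_same] using this
  have hp : γ p = γ' p := by
    have h1 := Finsupp.erase_add_single p γ
    have h2 := Finsupp.erase_add_single p γ'
    have hd1 : γ.degree = (γ.erase p).degree + γ p := by
      conv_lhs => rw [← h1]
      rw [map_add, Finsupp.degree_single]
    have hd2 : γ'.degree = (γ'.erase p).degree + γ' p := by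
      conv_lhs => rw [← h2]
      rw [map_add, Finsupp.degree_single]
    rw [hd1, hd2, he] at hd
    exact Nat.add_left_cancel hd
  rw [← Finsupp.erase_add_single p γ, ← Finsupp.erase_add_single p γ', he, hp]

/-- **The degree-`m` part survives.** For `F ∈ (X)^m`... (no hypothesis on `F` is needed here): for `|α| = m`, the coefficient of
`X^{α∖p}` in `(β_p F) /ᵐᵒⁿ X_p^m` is `coeff_α F`. [folklore] [OURS · L1 W4.5b] -/
theorem coeff_erase_divMonomial_blowupSubst (F : MvPolynomial τ R) {m : ℕ} {α : τ →₀ ℕ} (hα : α.degree = m) :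
    coeff (α.erase p) ((aeval (fun j => if j = p then (X p : MvPolynomial τ R) else X p * X j) F).divMonomial
      (Finsupp.single p m)) = coeff α F := by
  rw [coeff_divMonomial]
  conv_lhs => rw [F.as_sum, map_sum]
  simp_rw [aeval_blowupSubst_monomial]
  rw [coeff_sum]
  simp_rw [coeff_monomial]
  rw [Finset.sum_eq_single α]
  · rw [if_pos (by rw [hα])]
  · intro γ _ hγα
    rw [if_neg]
    intro h
    apply hγα
    apply blowupExponent_injective p
    change Finsupp.single p γ.degree + γ.erase p = Finsupp.single p α.degree + α.erase p
    rw [h, hα]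
  · intro hα0
    rw [if_pos (by rw [hα]), notMem_support_iff.mp hα0]

/-- **Exact order `m` ⇒ `X_p` does not divide the strict transform.** If some `coeff_α F ≠ 0` with `|α| = m`, then
`X_p ∤ (β_p F) /ᵐᵒⁿ X_p^m`. [folklore] [OURS · L1 W4.5b] -/
theorem not_X_dvd_divMonomial_blowupSubst (F : MvPolynomial τ R) {m : ℕ} {α : τ →₀ ℕ} (hα : α.degree = m)
    (hαF : coeff α F ≠ 0) :
    ¬ (X p : MvPolynomial τ R) ∣ (aeval (fun j => if j = p then (X p : MvPolynomial τ R) else X p * X j) F).divMonomial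
      (Finsupp.single p m) := by
  rintro ⟨h, hh⟩
  have hc := coeff_erase_divMonomial_blowupSubst p F hα
  rw [hh, coeff_X_mul', if_neg (by rw [Finsupp.mem_support_iff, Finsupp.erase_same]; exact fun h => h rfl)] at hc
  exact hαF hc.symm

/-- Exact order `m` ⇒ the strict transform is non-zero. [folklore] -/
theorem divMonomial_blowupSubst_ne_zero (F : MvPolynomial τ R) {m : ℕ} {α : τ →₀ ℕ} (hα : α.degree = m)
    (hαF : coeff α F ≠ 0) :
    (aeval (fun j => if j = p then (X p : MvPolynomial τ R) else X p * X j) F).divMonomial (Finsupp.single p m) ≠ 0 := by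
  intro h
  exact not_X_dvd_divMonomial_blowupSubst p F hα hαF (h ▸ dvd_zero _)

end Monomial

/-! ## Translation: square-freeness and exact order -/

section Translation

variable {R : Type*} [CommRing R] {τ : Type*}

/-- **Translation preserves square-freeness**: `f` square-free ⇒ `f(X + a)` square-free (`X ↦ X + a` is a ring automorphism with
inverse `X ↦ X − a`, part 1). [folklore] -/
theorem squarefree_aeval_X_add_C (a : τ → R) {f : MvPolynomial τ R} (hf : Squarefree f) :
    Squarefree (aeval (fun l : τ => (X l : MvPolynomial τ R) + C (a l)) f) := by
  let e : MvPolynomial τ R ≃ₐ[R] MvPolynomial τ R :=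
    AlgEquiv.ofAlgHom (aeval fun l : τ => (X l : MvPolynomial τ R) + C (a l))
      (aeval fun l : τ => (X l : MvPolynomial τ R) - C (a l))
      (MvPolynomial.algHom_ext fun l => by simp) (MvPolynomial.algHom_ext fun l => by simp)
  exact squarefree_map_of_mulEquiv e.toMulEquiv hf

/-- `f ∈ 𝔪_a^m ⇒ f(X + a) ∈ (X)^m`. [folklore] -/
theorem aeval_X_add_C_mem_pow_idealOfVars (a : τ → R) {m : ℕ} {f : MvPolynomial τ R}
    (hf : f ∈ (Ideal.span (Set.range fun l : τ => (X l : MvPolynomial τ R) - C (a l))) ^ m) :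
    aeval (fun l : τ => (X l : MvPolynomial τ R) + C (a l)) f ∈ idealOfVars τ R ^ m := by
  have h := Ideal.mem_map_of_mem (aeval fun l : τ => (X l : MvPolynomial τ R) + C (a l)) hf
  rwa [Ideal.map_pow, map_aeval_span_X_sub_C] at h

/-- **Exact order read on the translate.** `f ∈ 𝔪_a^m ∖ 𝔪_a^{m+1}` ⇒ some coefficient of degree exactly `m` of `f(X + a)` is non-zero.
[folklore] -/
theorem exists_coeff_ne_zero_of_not_mem_pow (a : τ → R) {m : ℕ} {f : MvPolynomial τ R}
    (hf : f ∈ (Ideal.span (Set.range fun l : τ => (X l : MvPolynomial τ R) - C (a l))) ^ m)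
    (hf' : f ∉ (Ideal.span (Set.range fun l : τ => (X l : MvPolynomial τ R) - C (a l))) ^ (m + 1)) :
    ∃ α : τ →₀ ℕ, α.degree = m ∧ coeff α (aeval (fun l : τ => (X l : MvPolynomial τ R) + C (a l)) f) ≠ 0 := by
  rw [mem_pow_span_X_sub_C_iff] at hf hf'
  push Not at hf'
  obtain ⟨α, hα, hαf⟩ := hf'
  refine ⟨α, ?_, hαf⟩
  by_contra hne
  exact hαf (hf α (by omega))

end Translation

/-! ## The strict-transform chart at a general point is square-free with finite bad set -/

section StChart

variable {k : Type} [Field k]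

/-- **The strict transform at a general point is square-free.** `f ∈ k[X_τ]` square-free with `f ∈ 𝔪_a^m ∖ 𝔪_a^{m+1}` (exact
multiplicity `m` at `a`), `p ∈ τ`: the strict-transform chart `st = (β_p (f(X + a))) /ᵐᵒⁿ X_p^m` is non-zero, `X_p ∤ st`, and `st` is
SQUARE-FREE (res-L1-w45b-stub-4's `squarefree_of_aeval_blowupSubst_eq`, p525038, after translation). [folklore] [OURS · L1 W4.5b] -/
theorem squarefree_stChart {τ : Type} [Fintype τ] [DecidableEq τ] (p : τ) (a : τ → k) {m : ℕ} {f : MvPolynomial τ k}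
    (hsq : Squarefree f)
    (hfm : f ∈ (Ideal.span (Set.range fun l : τ => (X l : MvPolynomial τ k) - C (a l))) ^ m)
    (hfm' : f ∉ (Ideal.span (Set.range fun l : τ => (X l : MvPolynomial τ k) - C (a l))) ^ (m + 1)) :
    (aeval (fun j => if j = p then (X p : MvPolynomial τ k) else X p * X j)
        (aeval (fun l : τ => (X l : MvPolynomial τ k) + C (a l)) f)).divMonomial (Finsupp.single p m) ≠ 0 ∧
      ¬ (X p : MvPolynomial τ k) ∣ (aeval (fun j => if j = p then (X p : MvPolynomial τ k) else X p * X j)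
        (aeval (fun l : τ => (X l : MvPolynomial τ k) + C (a l)) f)).divMonomial (Finsupp.single p m) ∧
      Squarefree ((aeval (fun j => if j = p then (X p : MvPolynomial τ k) else X p * X j)
        (aeval (fun l : τ => (X l : MvPolynomial τ k) + C (a l)) f)).divMonomial (Finsupp.single p m)) := by
  obtain ⟨α, hα, hαF⟩ := exists_coeff_ne_zero_of_not_mem_pow a hfm hfm'
  have hX := not_X_dvd_divMonomial_blowupSubst p _ hα hαF
  exact ⟨divMonomial_blowupSubst_ne_zero p _ hα hαF, hX,
    squarefree_of_aeval_blowupSubst_eq p (squarefree_aeval_X_add_C a hsq)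
      (X_pow_mul_divMonomial_eq_of_mem p (blowupSubst_shift_mem_span_X_pow p a hfm)).symm hX⟩

/-- **`hfinst` of part 9 discharged.** On a chart `i : Fin 3` of `ℙ²`: for a square-free `f ∈ k[T_{j ≠ i}]` (the REDUCED trace on the
chart, T-TCONE (R2)) of exact multiplicity `m` at the point `a` (`FatCluster` EXACT ORDER) and `p ≠ i`, the bad set of the
strict-transform chart `st_{a,p,m}(f)` — primes `𝔮 ∋ st` with `st ∈ 𝔪_𝔮²` — is FINITE (res-type-032's `finite_setOf_mem_sq_chart`, p516860).
[cite: Matsumura1987, Thm. 14.2] [OURS · L1 W4.5b] -/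
theorem finite_setOf_mem_sq_stChart (i : Fin 3) (p : {j : Fin 3 // j ≠ i}) (a : {j : Fin 3 // j ≠ i} → k) {m : ℕ}
    {f : MvPolynomial {j : Fin 3 // j ≠ i} k} (hsq : Squarefree f)
    (hfm : f ∈ (Ideal.span (Set.range fun l => (X l : MvPolynomial {j : Fin 3 // j ≠ i} k) - C (a l))) ^ m)
    (hfm' : f ∉ (Ideal.span (Set.range fun l => (X l : MvPolynomial {j : Fin 3 // j ≠ i} k) - C (a l))) ^ (m + 1)) :
    {𝔮 : PrimeSpectrum (MvPolynomial {j : Fin 3 // j ≠ i} k) |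
      (aeval (fun j => if j = p then (X p : MvPolynomial {j : Fin 3 // j ≠ i} k) else X p * X j)
          (aeval (fun l => (X l : MvPolynomial {j : Fin 3 // j ≠ i} k) + C (a l)) f)).divMonomial (Finsupp.single p m) ∈
        𝔮.asIdeal ∧
      algebraMap (MvPolynomial {j : Fin 3 // j ≠ i} k) (Localization.AtPrime 𝔮.asIdeal)
        ((aeval (fun j => if j = p then (X p : MvPolynomial {j : Fin 3 // j ≠ i} k) else X p * X j)
          (aeval (fun l => (X l : MvPolynomial {j : Fin 3 // j ≠ i} k) + C (a l)) f)).divMonomial (Finsupp.single p m)) ∈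
        maximalIdeal (Localization.AtPrime 𝔮.asIdeal) ^ 2}.Finite := by
  obtain ⟨h0, -, hsqst⟩ := squarefree_stChart p a hsq hfm hfm'
  exact finite_setOf_mem_sq_chart i h0 hsqst

end StChart

end Summit.ResolutionOfSingularities.ResolutionOfSingularities.Cruxes.EquisingularLiftNat.Sections

end
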